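import Mathlib
import Summits.HodgeConjecture.HodgeConjecture.Theses.TropicalKugaSatakeCayley
import Summits.HodgeConjecture.HodgeConjecture.Theorems.TropicalKugaSatakeCayleyCayleyHodgeRankTwoFlatCriterion
import Summits.HodgeConjecture.HodgeConjecture.Theorems.TropicalKugaSatakeCayleyCayleyHodgeRankTwoTransport
import Summits.HodgeConjecture.HodgeConjecture.Theorems.TropicalKugaSatakeCayleyCayleyHodgeRankTwoCuspForms
import Summits.HodgeConjecture.HodgeConjecture.Theorems.TropicalKugaSatakeCayleyCayleyHodgeRankTwoCuspMatrices
import Summits.HodgeConjecture.HodgeConjecture.Theorems.TropicalKugaSatakeCayleyCayleyHodgeRankTwoLefschetzTransfer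
import Summits.HodgeConjecture.HodgeConjecture.Theorems.TropicalKugaSatakeCayleyCayleyHodgeRankTwoIndependence
import Summits.HodgeConjecture.HodgeConjecture.Theorems.TropicalKugaSatakeCayleyCayleyHodgeRankTwoCertThetaRaise
import Summits.HodgeConjecture.HodgeConjecture.Theorems.TropicalKugaSatakeCayleyCayleyHodgeRankTwoCertThetaLower
import Summits.HodgeConjecture.HodgeConjecture.Theorems.TropicalKugaSatakeCayleyCayleyHodgeRankTwoCertCayleyRaiseA
import Summits.HodgeConjecture.HodgeConjecture.Theorems.TropicalKugaSatakeCayleyCayleyHodgeRankTwoCertCayleyRaiseB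
import Summits.HodgeConjecture.HodgeConjecture.Theorems.TropicalKugaSatakeCayleyCayleyHodgeRankTwoCertCayleyLowerA
import Summits.HodgeConjecture.HodgeConjecture.Theorems.TropicalKugaSatakeCayleyCayleyHodgeRankTwoCertCayleyLowerB

/-!
# Route `TropicalKugaSatakeCayley`, support S5 `CayleyHodgeRankTwo` (stmt-HodgeConjecture-18573) — assembly

**S5 (van Geemen–Verra Cor. 6.5 / Lemma 6.8, dual degree).** For every `z` with `Im z ∈ ksPosCone`, every
Kuga–Satake period map `Φ` of `z`, and every smooth projective model `X` of the torus
`ℂ⁸/(ℤ⁸ ⊕ τ(z)ℤ⁸)` (analytification `φ : ComplexTorus Φ → X(ℂ)`), there are two `ℂ`-linearly independent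
RATIONAL classes of HODGE TYPE `(6,6)` in `H¹²(X(ℂ); ℂ)`.

Proof (parts A1–A3, B3–B9, C of this series). The two classes are the classes of the constant `12`-forms
`c₁ = L⁴(θ²-table)` and `c₂ = L⁴(Cayley table)` on `Λ_ℝ = ℝ⁸_x ⊕ ℝ⁸_y` (`L = tkcLef` the Lefschetz
operator `Σ e^i ∧ f^i ∧ ·`; tables of part B3), read on `ℂ⁸` through `Φ⁻¹`:
* FLATNESS: the `(2,2)`-tables are killed by the slotwise derivations along the ten cusp operators
  (the kernel-checked certificates of part B8, via the expansion of part B4 and the operator data of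
  part B6); flatness passes to `L⁴` of the tables since `[D_N, L] = 0` (part B7, symmetry of `Bᵢ`, `Cⱼ`);
* TYPE `(6,6)`: by the flatness criterion (part A3: `J_z = A_R⁻¹ J_{iS} A_R`, the inverse formula
  `S⁻¹ ∈ span Cⱼ`, integration along `J_z`), a form killed by the ten derivations is of type `(p,p)` on
  EVERY member of the family;
* RATIONALITY on the lattice: integral tables and integral frame covectors (parts B7, B9);
* INDEPENDENCE: the tables are independent (values `(1,0)`, `(0,-8)` on two frame words) and
  `L⁴ : Λ⁴ → Λ¹²` is injective (pointwise hard Lefschetz, part B9);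
* TRANSPORT to `H¹²(X(ℂ); ℂ)` through the torus Hodge model of the analytification (part C).

Theorems only: no definition, no named fact, no sorry. The theorem `cayleyHodgeRankTwo_proof` has
literally the type of the route declaration.

## References

* [vanGeemenVerra2003QuaternionicPryms] B. van Geemen, A. Verra, Quaternionic Pryms and Hodge classes,
  Topology 42 (2003), §6.1, Cor. 6.5, Lemma 6.8.
* [LangeBirkenhake1992] H. Lange, Ch. Birkenhake, Complex Abelian Varieties (1992), §1.1, §8.1.
* [Voisin2002] C. Voisin, Hodge Theory and Complex Algebraic Geometry I (2002), §6.2, §7.2, §11.3.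
-/

noncomputable section

set_option linter.dupNamespace false

namespace Summit.HodgeConjecture.HodgeConjecture.Theorems

open Literature.AlgebraicGeometry.Tropical Literature.Geometry.Kaehler Literature.LinearAlgebra.Alternating
open Literature.AlgebraicGeometry.HodgeTheory Literature.NumberTheory.Transcendental
open scoped Matrix

/-! ### Flatness of the tables along the ten cusp operators -/

/-- The `θ²`-table is flat along the five raising operators. [cite: vanGeemenVerra2003QuaternionicPryms, Cor. 6.5] -/
theorem tkc_flat_theta_raise (i : Fin 5) (u : Fin 4 → (Fin 8 ⊕ Fin 8 → ℝ)) :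
    ∑ m, tkcTheta22 (Function.update u m (tkcRaise (tkcRaiseMat i) (u m))) = 0 := by
  fin_cases i
  exacts [tkc_flat_theta_raise_0 u, tkc_flat_theta_raise_1 u, tkc_flat_theta_raise_2 u,
    tkc_flat_theta_raise_3 u, tkc_flat_theta_raise_4 u]

/-- The Cayley table is flat along the five raising operators. [cite: vanGeemenVerra2003QuaternionicPryms, Cor. 6.5] -/
theorem tkc_flat_cayley_raise (i : Fin 5) (u : Fin 4 → (Fin 8 ⊕ Fin 8 → ℝ)) :
    ∑ m, tkcCayley22 (Function.update u m (tkcRaise (tkcRaiseMat i) (u m))) = 0 := by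
  fin_cases i
  exacts [tkc_flat_cayley_raise_0 u, tkc_flat_cayley_raise_1 u, tkc_flat_cayley_raise_2 u,
    tkc_flat_cayley_raise_3 u, tkc_flat_cayley_raise_4 u]

/-- The `θ²`-table is flat along the five lowering operators `N'ⱼ = tkcLower Cⱼ` (from the scaled integer
operators, `Cⱼ = sⱼ⁻¹ (sⱼCⱼ)`). [cite: vanGeemenVerra2003QuaternionicPryms, Cor. 6.5] -/
theorem tkc_flat_theta_lower (j : Fin 5) (u : Fin 4 → (Fin 8 ⊕ Fin 8 → ℝ)) :
    ∑ m, tkcTheta22 (Function.update u m (tkcLower (tkcLowerMat j) (u m))) = 0 := by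
  rw [tkc_lower_lowerMat_eq_smul]
  refine tkc_flat_smul_op _ _ _ ?_ u
  intro v
  fin_cases j
  exacts [tkc_flat_theta_lowerInt_0 v, tkc_flat_theta_lowerInt_1 v, tkc_flat_theta_lowerInt_2 v,
    tkc_flat_theta_lowerInt_3 v, tkc_flat_theta_lowerInt_4 v]

/-- The Cayley table is flat along the five lowering operators. [cite: vanGeemenVerra2003QuaternionicPryms, Cor. 6.5] -/
theorem tkc_flat_cayley_lower (j : Fin 5) (u : Fin 4 → (Fin 8 ⊕ Fin 8 → ℝ)) :
    ∑ m, tkcCayley22 (Function.update u m (tkcLower (tkcLowerMat j) (u m))) = 0 := by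
  rw [tkc_lower_lowerMat_eq_smul]
  refine tkc_flat_smul_op _ _ _ ?_ u
  intro v
  fin_cases j
  exacts [tkc_flat_cayley_lowerInt_0 v, tkc_flat_cayley_lowerInt_1 v, tkc_flat_cayley_lowerInt_2 v,
    tkc_flat_cayley_lowerInt_3 v, tkc_flat_cayley_lowerInt_4 v]

/-! ### Flatness of `L⁴` of a flat `4`-form -/

/-- **Flatness along a raising operator passes to `L⁴ κ`** (`[D_N, L] = 0`, `Bᵢ` symmetric).
[cite: LangeBirkenhake1992, §1.1.5] -/
theorem tkc_flat_lef4_raise (i : Fin 5) (κ : (Fin 8 ⊕ Fin 8 → ℝ) [⋀^Fin 4]→L[ℝ] ℂ)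
    (hκ : ∀ u : Fin 4 → (Fin 8 ⊕ Fin 8 → ℝ), ∑ m, κ (Function.update u m (tkcRaise (tkcRaiseMat i) (u m))) = 0)
    (u : Fin 12 → (Fin 8 ⊕ Fin 8 → ℝ)) :
    ∑ m, (tkcLef (tkcLef (tkcLef (tkcLef κ)))) (Function.update u m (tkcRaise (tkcRaiseMat i) (u m))) = 0 := by
  have hB : ∀ c a : Fin 8, tkcRaiseMat i c a = tkcRaiseMat i a c := by
    intro c a
    rw [tkcRaiseMat_eq, Matrix.map_apply, Matrix.map_apply, tkc_ksForm_symm]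
  have hθ : ∀ (c : Fin 8) (x : Fin 8 ⊕ Fin 8 → ℝ),
      tkcFrame (Fin.castAdd 8 c) (tkcRaise (tkcRaiseMat i) x) =
        ∑ a, tkcRaiseMat i c a * tkcFrame (Fin.natAdd 8 a) x := by
    intro c x
    simp only [tkcFrame_apply, tkcRaise_apply, finSumFinEquiv_symm_apply_castAdd,
      finSumFinEquiv_symm_apply_natAdd, Sum.elim_inl, Matrix.mulVec, dotProduct]
  have hθ' : ∀ (c : Fin 8) (x : Fin 8 ⊕ Fin 8 → ℝ), tkcFrame (Fin.natAdd 8 c) (tkcRaise (tkcRaiseMat i) x) = 0 := by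
    intro c x
    simp only [tkcFrame_apply, tkcRaise_apply, finSumFinEquiv_symm_apply_natAdd, Sum.elim_inr,
      Pi.zero_apply]
  have step : ∀ {n : ℕ} (η : (Fin 8 ⊕ Fin 8 → ℝ) [⋀^Fin n]→L[ℝ] ℂ),
      (∀ v : Fin n → (Fin 8 ⊕ Fin 8 → ℝ), ∑ m, η (Function.update v m (tkcRaise (tkcRaiseMat i) (v m))) = 0) →
      ∀ v : Fin (n + 1 + 1) → (Fin 8 ⊕ Fin 8 → ℝ),
        ∑ m, (tkcLef η) (Function.update v m (tkcRaise (tkcRaiseMat i) (v m))) = 0 := by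
    intro n η hη v
    rw [tkcLef_eq]
    exact tkc_flat_lef_raise (fun c => tkcFrame (Fin.castAdd 8 c)) (fun c => tkcFrame (Fin.natAdd 8 c))
      (tkcRaise (tkcRaiseMat i)) (fun c a => tkcRaiseMat i c a) hB hθ hθ' η hη v
  exact step _ (step _ (step _ (step _ hκ))) u

/-- **Flatness along a lowering operator passes to `L⁴ κ`** (`[D_N', L] = 0`, `Cⱼ` symmetric).
[cite: LangeBirkenhake1992, §1.1.5] -/
theorem tkc_flat_lef4_lower (j : Fin 5) (κ : (Fin 8 ⊕ Fin 8 → ℝ) [⋀^Fin 4]→L[ℝ] ℂ)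
    (hκ : ∀ u : Fin 4 → (Fin 8 ⊕ Fin 8 → ℝ), ∑ m, κ (Function.update u m (tkcLower (tkcLowerMat j) (u m))) = 0)
    (u : Fin 12 → (Fin 8 ⊕ Fin 8 → ℝ)) :
    ∑ m, (tkcLef (tkcLef (tkcLef (tkcLef κ)))) (Function.update u m (tkcLower (tkcLowerMat j) (u m))) = 0 := by
  have hC : ∀ c a : Fin 8, tkcLowerMat j c a = tkcLowerMat j a c := by
    intro c a
    rw [tkc_lowerMat_eq_smul, Matrix.smul_apply, Matrix.smul_apply, Matrix.map_apply, Matrix.map_apply,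
      tkc_lowerInt_symm]
  have hθ : ∀ (c : Fin 8) (x : Fin 8 ⊕ Fin 8 → ℝ), tkcFrame (Fin.castAdd 8 c) (tkcLower (tkcLowerMat j) x) = 0 := by
    intro c x
    simp only [tkcFrame_apply, tkcLower_apply, finSumFinEquiv_symm_apply_castAdd, Sum.elim_inl,
      Pi.zero_apply]
  have hθ' : ∀ (c : Fin 8) (x : Fin 8 ⊕ Fin 8 → ℝ),
      tkcFrame (Fin.natAdd 8 c) (tkcLower (tkcLowerMat j) x) =
        ∑ a, tkcLowerMat j c a * tkcFrame (Fin.castAdd 8 a) x := by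
    intro c x
    simp only [tkcFrame_apply, tkcLower_apply, finSumFinEquiv_symm_apply_castAdd,
      finSumFinEquiv_symm_apply_natAdd, Sum.elim_inr, Matrix.mulVec, dotProduct]
  have step : ∀ {n : ℕ} (η : (Fin 8 ⊕ Fin 8 → ℝ) [⋀^Fin n]→L[ℝ] ℂ),
      (∀ v : Fin n → (Fin 8 ⊕ Fin 8 → ℝ), ∑ m, η (Function.update v m (tkcLower (tkcLowerMat j) (v m))) = 0) →
      ∀ v : Fin (n + 1 + 1) → (Fin 8 ⊕ Fin 8 → ℝ),
        ∑ m, (tkcLef η) (Function.update v m (tkcLower (tkcLowerMat j) (v m))) = 0 := by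
    intro n η hη v
    rw [tkcLef_eq]
    exact tkc_flat_lef_lower (fun c => tkcFrame (Fin.castAdd 8 c)) (fun c => tkcFrame (Fin.natAdd 8 c))
      (tkcLower (tkcLowerMat j)) (fun c a => tkcLowerMat j c a) hC hθ hθ' η hη v
  exact step _ (step _ (step _ (step _ hκ))) u

/-! ### Type `(6,6)` on every member, rational values on the lattice -/

/-- **`L⁴` of a cusp-flat table is of type `(6,6)` on every member of the family** (the flatness
criterion, part A3). [cite: vanGeemenVerra2003QuaternionicPryms, §6.1] -/
theorem tkc_isConstOfType_lef4 (κ : (Fin 8 ⊕ Fin 8 → ℝ) [⋀^Fin 4]→L[ℝ] ℂ)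
    (hR : ∀ (i : Fin 5) (u : Fin 4 → (Fin 8 ⊕ Fin 8 → ℝ)),
      ∑ m, κ (Function.update u m (tkcRaise (tkcRaiseMat i) (u m))) = 0)
    (hL : ∀ (j : Fin 5) (u : Fin 4 → (Fin 8 ⊕ Fin 8 → ℝ)),
      ∑ m, κ (Function.update u m (tkcLower (tkcLowerMat j) (u m))) = 0)
    {z : Fin 5 → ℂ} (hz : (fun k => (z k).im) ∈ ksPosCone)
    {Φ : (Fin 8 ⊕ Fin 8 → ℝ) ≃L[ℝ] (Fin 8 → ℂ)} (hΦ : IsKSPeriodMap z Φ) :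
    ComplexTorus.IsConstOfType 6 6 ((tkcLef (tkcLef (tkcLef (tkcLef κ)))).compContinuousLinearMap
      (Φ.symm : (Fin 8 → ℂ) →L[ℝ] (Fin 8 ⊕ Fin 8 → ℝ))) :=
  tkc_isConstOfType_of_cusp_derivations (p := 6) (by norm_num) _
    (fun i w => tkc_flat_lef4_raise i κ (hR i) w) (fun j w => tkc_flat_lef4_lower j κ (hL j) w) hz hΦ

/-- **`L⁴` of an integral table takes rational values on words of lattice basis vectors.**
[cite: LangeBirkenhake1992, §1.1.4] -/
theorem tkc_lef4_table_apply_vec_mem_range {m : ℕ} (word : Fin m → (Fin 4 → Fin 16)) (coef : Fin m → ℤ)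
    (w : Fin 12 → Fin 16) :
    (tkcLef (tkcLef (tkcLef (tkcLef (tkcTable word coef))))) (tkcVec ∘ w) ∈ Set.range (algebraMap ℚ ℂ) := by
  have step : ∀ {n : ℕ} (η : (Fin 8 ⊕ Fin 8 → ℝ) [⋀^Fin n]→L[ℝ] ℂ),
      (∀ v : Fin n → Fin 16, η (tkcVec ∘ v) ∈ Set.range (algebraMap ℚ ℂ)) →
      ∀ v : Fin (n + 1 + 1) → Fin 16, (tkcLef η) (tkcVec ∘ v) ∈ Set.range (algebraMap ℚ ℂ) := by
    intro n η hη v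
    rw [tkcLef_eq]
    exact tkc_lef_apply_vec_mem_range tkcVec (fun c => tkcFrame (Fin.castAdd 8 c))
      (fun c => tkcFrame (Fin.natAdd 8 c)) tkc_frame_castAdd_vec_int tkc_frame_natAdd_vec_int η hη v
  refine step _ (step _ (step _ (step _ ?_))) w
  intro v
  rw [tkcTable_eq]
  exact tkc_table_apply_vec_mem_range tkcVec tkcFrame tkcFrame_tkcVec word coef v

/-! ### The pair of forms on `ℂ⁸` -/

/-- The two `(6,6)`-forms read through `Φ⁻¹` are of type `(6,6)` for the complex structure of the member
`z`. [cite: vanGeemenVerra2003QuaternionicPryms, §6.1] -/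
theorem tkc_pair_isConstOfType {z : Fin 5 → ℂ} (hz : (fun k => (z k).im) ∈ ksPosCone)
    {Φ : (Fin 8 ⊕ Fin 8 → ℝ) ≃L[ℝ] (Fin 8 → ℂ)} (hΦ : IsKSPeriodMap z Φ) :
    ∀ i : Fin 2, ComplexTorus.IsConstOfType 6 6
      ((![(tkcLef (tkcLef (tkcLef (tkcLef tkcTheta22)))).compContinuousLinearMap
            (Φ.symm : (Fin 8 → ℂ) →L[ℝ] (Fin 8 ⊕ Fin 8 → ℝ)),
          (tkcLef (tkcLef (tkcLef (tkcLef tkcCayley22)))).compContinuousLinearMap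
            (Φ.symm : (Fin 8 → ℂ) →L[ℝ] (Fin 8 ⊕ Fin 8 → ℝ))] :
        Fin 2 → ((Fin 8 → ℂ) [⋀^Fin 12]→L[ℝ] ℂ)) i) := by
  rw [Fin.forall_fin_two]
  exact ⟨tkc_isConstOfType_lef4 tkcTheta22 tkc_flat_theta_raise tkc_flat_theta_lower hz hΦ,
    tkc_isConstOfType_lef4 tkcCayley22 tkc_flat_cayley_raise tkc_flat_cayley_lower hz hΦ⟩

/-- The lattice basis vectors `Φ(e_b)` read back through `Φ⁻¹` are the frame vectors `b`. [folklore] -/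
theorem tkc_symm_comp_single (Φ : (Fin 8 ⊕ Fin 8 → ℝ) ≃L[ℝ] (Fin 8 → ℂ)) (v : Fin 12 → Fin 8 ⊕ Fin 8) :
    ((Φ.symm : (Fin 8 → ℂ) →L[ℝ] (Fin 8 ⊕ Fin 8 → ℝ)) ∘ fun j => Φ (Pi.single (v j) (1 : ℝ))) =
      tkcVec ∘ (fun j => finSumFinEquiv (v j)) := by
  funext j
  simp only [Function.comp_apply, ContinuousLinearEquiv.coe_coe, ContinuousLinearEquiv.symm_apply_apply,
    tkcVec_eq, Equiv.symm_apply_apply]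

/-- `L⁴(θ²-table)` read through `Φ⁻¹` is rational on words of lattice basis vectors.
[cite: LangeBirkenhake1992, §1.1.4] -/
theorem tkc_theta_lef4_comp_rat (Φ : (Fin 8 ⊕ Fin 8 → ℝ) ≃L[ℝ] (Fin 8 → ℂ)) (v : Fin 12 → Fin 8 ⊕ Fin 8) :
    ((tkcLef (tkcLef (tkcLef (tkcLef tkcTheta22)))).compContinuousLinearMap
        (Φ.symm : (Fin 8 → ℂ) →L[ℝ] (Fin 8 ⊕ Fin 8 → ℝ))) (fun j => Φ (Pi.single (v j) 1)) ∈
      Set.range (algebraMap ℚ ℂ) := by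
  rw [ContinuousAlternatingMap.compContinuousLinearMap_apply, tkc_symm_comp_single Φ v, tkcTheta22_eq]
  exact tkc_lef4_table_apply_vec_mem_range tkcThetaWord (fun _ => 1) _

/-- `L⁴(Cayley table)` read through `Φ⁻¹` is rational on words of lattice basis vectors.
[cite: LangeBirkenhake1992, §1.1.4] -/
theorem tkc_cayley_lef4_comp_rat (Φ : (Fin 8 ⊕ Fin 8 → ℝ) ≃L[ℝ] (Fin 8 → ℂ)) (v : Fin 12 → Fin 8 ⊕ Fin 8) :
    ((tkcLef (tkcLef (tkcLef (tkcLef tkcCayley22)))).compContinuousLinearMap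
        (Φ.symm : (Fin 8 → ℂ) →L[ℝ] (Fin 8 ⊕ Fin 8 → ℝ))) (fun j => Φ (Pi.single (v j) 1)) ∈
      Set.range (algebraMap ℚ ℂ) := by
  rw [ContinuousAlternatingMap.compContinuousLinearMap_apply, tkc_symm_comp_single Φ v, tkcCayley22_eq]
  exact tkc_lef4_table_apply_vec_mem_range tkcCayleyWord tkcCayleyCoef _

/-- The two `(6,6)`-forms read through `Φ⁻¹` take rational values on the words of lattice basis vectors
`Φ(e_b)`. [cite: LangeBirkenhake1992, §1.1.4] -/
theorem tkc_pair_rat (Φ : (Fin 8 ⊕ Fin 8 → ℝ) ≃L[ℝ] (Fin 8 → ℂ)) :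
    ∀ (i : Fin 2) (v : Fin 12 → Fin 8 ⊕ Fin 8),
      (![(tkcLef (tkcLef (tkcLef (tkcLef tkcTheta22)))).compContinuousLinearMap
            (Φ.symm : (Fin 8 → ℂ) →L[ℝ] (Fin 8 ⊕ Fin 8 → ℝ)),
          (tkcLef (tkcLef (tkcLef (tkcLef tkcCayley22)))).compContinuousLinearMap
            (Φ.symm : (Fin 8 → ℂ) →L[ℝ] (Fin 8 ⊕ Fin 8 → ℝ))] :
        Fin 2 → ((Fin 8 → ℂ) [⋀^Fin 12]→L[ℝ] ℂ)) i (fun j => Φ (Pi.single (v j) 1)) ∈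
        Set.range (algebraMap ℚ ℂ) := by
  rw [Fin.forall_fin_two]
  exact ⟨tkc_theta_lef4_comp_rat Φ, tkc_cayley_lef4_comp_rat Φ⟩

/-- The two `(6,6)`-forms read through `Φ⁻¹` are `ℂ`-linearly independent.
[cite: vanGeemenVerra2003QuaternionicPryms, Cor. 6.5] -/
theorem tkc_pair_linearIndependent (Φ : (Fin 8 ⊕ Fin 8 → ℝ) ≃L[ℝ] (Fin 8 → ℂ)) :
    LinearIndependent ℂ
      (![(tkcLef (tkcLef (tkcLef (tkcLef tkcTheta22)))).compContinuousLinearMap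
            (Φ.symm : (Fin 8 → ℂ) →L[ℝ] (Fin 8 ⊕ Fin 8 → ℝ)),
          (tkcLef (tkcLef (tkcLef (tkcLef tkcCayley22)))).compContinuousLinearMap
            (Φ.symm : (Fin 8 → ℂ) →L[ℝ] (Fin 8 ⊕ Fin 8 → ℝ))] :
        Fin 2 → ((Fin 8 → ℂ) [⋀^Fin 12]→L[ℝ] ℂ)) := by
  rw [Fintype.linearIndependent_iff]
  intro g hg
  have hu : ∀ u : Fin 12 → (Fin 8 ⊕ Fin 8 → ℝ),
      ((Φ.symm : (Fin 8 → ℂ) →L[ℝ] (Fin 8 ⊕ Fin 8 → ℝ)) ∘ (Φ ∘ u)) = u := by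
    intro u
    funext j
    simp only [Function.comp_apply, ContinuousLinearEquiv.coe_coe, ContinuousLinearEquiv.symm_apply_apply]
  have hst := tkc_lef4_tables_indep (g 0) (g 1) (fun u => by
    have h := congrArg (fun f : (Fin 8 → ℂ) [⋀^Fin 12]→L[ℝ] ℂ => f (Φ ∘ u)) hg
    simp only [Fin.sum_univ_two, Matrix.cons_val_zero, Matrix.cons_val_one,
      ContinuousAlternatingMap.add_apply, ContinuousAlternatingMap.smul_apply,
      ContinuousAlternatingMap.compContinuousLinearMap_apply, hu u,
      ContinuousAlternatingMap.coe_zero, Pi.zero_apply, smul_eq_mul] at h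
    exact h)
  intro i
  fin_cases i
  · exact hst.1
  · exact hst.2

/-! ### S5 -/

/-- **S5 `CayleyHodgeRankTwo`** (van Geemen–Verra Cor. 6.5 / Lemma 6.8 in dual degree, for the explicit
Kuga–Satake family): every member `ℂ⁸/(ℤ⁸ ⊕ τ(z)ℤ⁸)`, `Im z ∈ ksPosCone`, and every smooth projective
model `X` of it carry two `ℂ`-linearly independent rational Hodge classes of type `(6,6)` in
`H¹²(X(ℂ); ℂ)` — the classes of `L⁴(θ²-table)` and `L⁴(Cayley table)`.
[cite: vanGeemenVerra2003QuaternionicPryms, Cor. 6.5 and Lemma 6.8] -/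
theorem cayleyHodgeRankTwo_proof :
    Summit.HodgeConjecture.HodgeConjecture.Theses.TropicalKugaSatakeCayley.CayleyHodgeRankTwo := by
  intro z hz Φ hΦ X _hX φ hφ
  obtain ⟨c, hc1, hc2, hc3⟩ := tkc_transport_constForms Φ φ hφ
    (![(tkcLef (tkcLef (tkcLef (tkcLef tkcTheta22)))).compContinuousLinearMap
          (Φ.symm : (Fin 8 → ℂ) →L[ℝ] (Fin 8 ⊕ Fin 8 → ℝ)),
        (tkcLef (tkcLef (tkcLef (tkcLef tkcCayley22)))).compContinuousLinearMap
          (Φ.symm : (Fin 8 → ℂ) →L[ℝ] (Fin 8 ⊕ Fin 8 → ℝ))] :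
      Fin 2 → ((Fin 8 → ℂ) [⋀^Fin 12]→L[ℝ] ℂ))
    (tkc_pair_rat Φ) (tkc_pair_isConstOfType hz hΦ) (tkc_pair_linearIndependent Φ)
  exact ⟨c, hc1, hc2, hc3⟩

end Summit.HodgeConjecture.HodgeConjecture.Theorems

end
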